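import Literature.Probability.LatticeModels.FKBallPassage
import Literature.Probability.LatticeModels.FKIsingRSWOfBallArm
import Literature.Probability.LatticeModels.FKExplorationClock
import Literature.Probability.LatticeModels.FKSlitLowerBound
import HarnessLib

/-!
# DCHN's Lemma 15 (the strong half-plane one-arm bound for balls), proved

Topic `Literature/Probability/LatticeModels`; the last reduction of the discharge of the named fact
`fkIsing_rsw` (Duminil-Copin–Hongler–Nolin 2011, Thm. 1 / Duminil-Copin–Smirnov 2012, Thm. 3.16).
After `FKIsingRSWOfBallArm.fkIsing_rsw_of_ballArmBound`, `fkIsing_rsw` rests on the ball version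
`(hB)` of DCHN's Lemma 15: `φ^{3 wired}_{[0,N]×[0,2N]}(B_k((0,N)) ↔ wired sides) ≤ C_B ((k+1)/N)^a`,
proved here (`fkIsing_ballArmBound`) following the printed proof (Duminil-Copin 2013, Lemma 10.7;
DCHN 2011, proof of Lemma 15): explore the interface of the three-sided Dobrushin box `thrD N` up to
its first visit of the diamond `◇_K ⊇ B_k` (`K = 2k + 1`), condition on the prefix, bound the
conditional probability that the right-most point `z = (N + K, 0)` of the diamond is joined to the
wired arc from below by the slit-domain lower bound `famProb_openJoined_z_ge` of
`FKSlitLowerBound.lean` (`≥ c/√K`), sum over the prefix classes, and bound `P(z ↔ wired arc)` from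
above by the point estimate (`≤ 2/√(N - K + 4)`, `openJoined_sq_le_threeSided`).

* `IsBallSite`, `ballJoined`, `diamondHit`, **`ballJoined_subset_diamondHit`**: if a site of the
  half-ball `B_k` about `(N, 0)` is joined to the wired arc, the exploration turns at a diamond site
  before its exit (pillar passage, `FKBallPassage.lean`);
* `firstDiamondVisit n`: disjoint, cover `diamondHit`, vanish beyond the sure step bound, unions of
  prefix cylinders (`explorationCylinder_subset_firstDiamondVisit`);
* `fkDobrushin_real_eq_sum` (the measure as a finite weighted sum), `real_cylinder_inter_eq`
  (`P(C ∩ Z) = P_C(Z) · P(C)` for a prefix cylinder `C`, `P_C = famProb`),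
  **`mul_real_diamondHit_le`** (`κ ≤ P_C(Z)` for every first-visit cylinder ⇒ `κ P(diamondHit) ≤ P(Z)`);
* the bridge `fkIsing_threeBallArm_eq_real_ballJoined` to the three-wired rectangle measure and the
  point estimate `real_openJoined_ballCorner_le`;
* **`fkIsing_ballArmBound`**: `(hB)` with `a = 1/2`.

Everything here is proved; no named fact is introduced; nothing assumes `fkIsing_rsw`.

## References

* H. Duminil-Copin, C. Hongler, P. Nolin, *Connection probabilities and RSW-type bounds for the
  two-dimensional FK Ising model*, Comm. Pure Appl. Math. 64 (2011) 1165–1198 (arXiv:0912.4253),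
  §4, Lemma 15 and Proposition 14 — bib key `DuminilCopinHonglerNolin2011`.
* H. Duminil-Copin, *Parafermionic observables and their applications to planar statistical physics
  models*, Ensaios Matemáticos 25 (2013), Lemma 10.7.
* H. Duminil-Copin, S. Smirnov, *Conformal invariance of lattice models*, Clay Math. Proc. 15
  (2012), §6.2, Lemma 6.6 — bib key `DuminilCopinSmirnov2012Clay`.
* G. Grimmett, *The Random-Cluster Model* (2006), §1.2 and Lemma (4.13) — bib key `Grimmett2006`.
-/

noncomputable section

namespace Literature.Probability.LatticeModels

namespace LatticeDobrushin

open MeasureTheory Finset SimpleGraph DiscreteDobrushin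

/-! ### Ball sites of the three-sided box and the pillar below a ball site -/

section Ball

variable (N k : ℕ)

/-- The sites of the half-box of radius `k` about `(N, 0)` in the three-sided box of width `2N`:
`N - k ≤ X ≤ N + k`, `0 ≤ Y ≤ k` (the transposed image of `centreBall N k`). [folklore] -/
def IsBallSite (u : Site 2) : Prop := (N : ℤ) - k ≤ u 0 ∧ u 0 ≤ N + k ∧ 0 ≤ u 1 ∧ u 1 ≤ k

/-- The event that the exploration of the three-sided box turns at a site of the diamond `◇_K`
before its exit ("the exploration path reaches the medial edges bordering the vertices of
`B_k(x)`"). [cite: DuminilCopinHonglerNolin2011, §4, proof of Lemma 15] -/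
def diamondHit (N K : ℕ) (hN : 1 ≤ N) : Set (Percolation.BondConfig (Site 2)) :=
  {ω | ∃ j < exitTime (thrD_adm hN) ω, IsDiamondSite N K (orbT N hN ω j).1}

/-- The event that some ball site is joined to the wired arc by open edges ("`B_k(x)` is connected
to the wired arc"). [cite: DuminilCopinHonglerNolin2011, §4, Lemma 15] -/
def ballJoined : Set (Percolation.BondConfig (Site 2)) :=
  {ω | ∃ v : ThrV N, IsBallSite N k v.1 ∧ (thrD N).OpenJoinedToArcA v ω}

variable {N k}

/-- **If the ball is joined to the wired arc, the exploration turns at a diamond site** of every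
diamond `◇_K ⊇ B_k` (`2k ≤ K`): pillar passage below a joined ball site.
[cite: DuminilCopinHonglerNolin2011, §4, proof of Lemma 15] -/
theorem ballJoined_subset_diamondHit (hN : 1 ≤ N) (hk : k + 1 ≤ N) {K : ℕ} (hK : 2 * k ≤ K) :
    ballJoined N k ⊆ diamondHit N K hN := by
  intro ω hω
  obtain ⟨v, ⟨h0, h0', h1, h1'⟩, hjoin⟩ := hω
  have hE := thrD_adm hN
  set u : Site 2 := ![v.1 0, 0] with hu
  set m : ℕ := (v.1 1).toNat with hm
  have hm' : (m : ℤ) = v.1 1 := by rw [hm, Int.toNat_of_nonneg h1]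
  have hps : ∀ i : ℕ, pillarSite u i = ![v.1 0, (i : ℤ)] := by
    intro i; funext j; fin_cases j <;> simp [pillarSite, hu]
  have htop : pillarSite u m = v.1 := by
    rw [hps]; funext j; fin_cases j
    · rfl
    · simp [hm']
  obtain ⟨j, hj, i, hi, hji⟩ := exists_lt_exitTime_cornerOrbit_fst_eq_pillarSite hE ω
    (preconnected_zdArcA_threeSided (W := 2 * N) (H := N)) u m
    (fun i hi => by
      rw [hps, isInnerFace_threeSided_iff]; simp [faceAt, cornerOff]; omega)
    (fun i hi => by
      rw [hps, isInnerFace_threeSided_iff]; simp [faceAt, cornerOff]; omega)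
    (by
      have hc := reflTransGen_freeSideAdj_threeSided (W := 2 * N) (H := N) (v.1 0).toNat (by
        rw [Int.toNat_of_nonneg (by omega)]; push_cast; omega)
      rw [Int.toNat_of_nonneg (by omega)] at hc
      have e1 : cFace (DiscreteDobrushin.startCorner hE) = ![0, -1] := by
        rw [startCorner_threeSided (W := 2 * N) (H := N) (by omega) hN]
        show faceAt ![0, 0] 3 = _
        funext i; fin_cases i <;> simp [faceAt, cornerOff]
      have e2 : faceAt u 3 = ![v.1 0, -1] := by
        funext i; fin_cases i <;> simp [faceAt, cornerOff, hu]
      rw [e1, e2]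
      exact reflTransGen_closed_of_freeSideAdj hE ω hc)
    (by rw [htop]; exact exists_reachable_of_openJoinedToArcA hjoin)
  refine ⟨j, hj, ?_⟩
  show IsDiamondSite N K (cornerOrbit _ _ j).1
  rw [hji, hps]
  refine ⟨?_, ?_, ?_⟩ <;> simp <;> omega

end Ball

/-! ### Summing a lower bound over the classes of a partition -/

open scoped Classical in
/-- **Summing a conditional lower bound over classes.** Let `μ(X) = ∑_{a ∈ F} w(a) · 1[L a ∈ X]` be
a finitely supported nonnegative weighting of configurations, `S` a set which is a union of
classes `cls ω` (`ω ∈ cls ω`, `cls ω ⊆ S` for `ω ∈ S`, and `cls ω' = cls ω` for `ω' ∈ cls ω`), and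
suppose `κ μ(cls ω) ≤ μ(cls ω ∩ Z)` for every `ω ∈ S`. Then `κ μ(S) ≤ μ(S ∩ Z)`. (Regroup both
sums by class.) [folklore] -/
theorem mul_sum_le_sum_inter_of_classes {α Ω : Type*} (F : Finset α) (w : α → ℝ) (L : α → Ω)
    (S Z : Set Ω) (cls : Ω → Set Ω)
    (hself : ∀ ω ∈ S, ω ∈ cls ω) (hsub : ∀ ω ∈ S, cls ω ⊆ S)
    (heq : ∀ ω ∈ S, ∀ ω' ∈ cls ω, cls ω' = cls ω) {κ : ℝ}
    (hcls : ∀ ω ∈ S, κ * ∑ a ∈ F with L a ∈ cls ω, w a ≤ ∑ a ∈ F with L a ∈ cls ω ∩ Z, w a) :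
    κ * ∑ a ∈ F with L a ∈ S, w a ≤ ∑ a ∈ F with L a ∈ S ∩ Z, w a := by
  classical
  -- regroup by the class of `L a`
  set T : Finset (Set Ω) := (F.filter fun a => L a ∈ S).image fun a => cls (L a) with hT
  have hmaps : ∀ a ∈ F.filter (fun a => L a ∈ S), cls (L a) ∈ T := fun a ha => Finset.mem_image_of_mem _ ha
  have hmapsZ : ∀ a ∈ F.filter (fun a => L a ∈ S ∩ Z), cls (L a) ∈ T := fun a ha => by
    rw [Finset.mem_filter] at ha
    exact Finset.mem_image_of_mem _ (Finset.mem_filter.2 ⟨ha.1, ha.2.1⟩)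
  rw [← Finset.sum_fiberwise_of_maps_to hmaps, ← Finset.sum_fiberwise_of_maps_to hmapsZ, Finset.mul_sum]
  refine Finset.sum_le_sum fun c hc => ?_
  obtain ⟨a₀, ha₀, rfl⟩ := Finset.mem_image.1 hc
  rw [Finset.mem_filter] at ha₀
  have hS₀ : L a₀ ∈ S := ha₀.2
  -- the fibre over the class of `L a₀` inside `S` is the class itself
  have hfib : (F.filter (fun a => L a ∈ S)).filter (fun a => cls (L a) = cls (L a₀)) =
      F.filter (fun a => L a ∈ cls (L a₀)) := by
    ext a
    simp only [Finset.mem_filter]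
    constructor
    · rintro ⟨⟨haF, haS⟩, hca⟩
      exact ⟨haF, hca ▸ hself _ haS⟩
    · rintro ⟨haF, hac⟩
      exact ⟨⟨haF, hsub _ hS₀ hac⟩, heq _ hS₀ _ hac⟩
  have hfibZ : (F.filter (fun a => L a ∈ S ∩ Z)).filter (fun a => cls (L a) = cls (L a₀)) =
      F.filter (fun a => L a ∈ cls (L a₀) ∩ Z) := by
    ext a
    simp only [Finset.mem_filter, Set.mem_inter_iff]
    constructor
    · rintro ⟨⟨haF, haS, haZ⟩, hca⟩
      exact ⟨haF, hca ▸ hself _ haS, haZ⟩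
    · rintro ⟨haF, hac, haZ⟩
      exact ⟨⟨haF, hsub _ hS₀ hac, haZ⟩, heq _ hS₀ _ hac⟩
  rw [hfib, hfibZ]
  exact hcls _ hS₀

/-! ### The first visit of the diamond and the prefix events -/

section FirstHit

/-- The event that the exploration turns at a diamond site for the first time at step `n`, before
its exit. [cite: DuminilCopinHonglerNolin2011, §4, proof of Lemma 15] -/
def firstDiamondVisit (N K : ℕ) (hN : 1 ≤ N) (n : ℕ) : Set (Percolation.BondConfig (Site 2)) :=
  {ω | IsFirstDiamondVisit N K hN ω n}

variable {N K : ℕ} {hN : 1 ≤ N}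

/-- A visit of the diamond has a first time. [folklore] -/
theorem diamondHit_subset_iUnion_firstDiamondVisit : diamondHit N K hN ⊆ ⋃ n, firstDiamondVisit N K hN n := by
  classical
  intro ω hω
  obtain ⟨j, hj, hball⟩ := hω
  have hex : ∃ n, IsDiamondSite N K (orbT N hN ω n).1 := ⟨j, hball⟩
  refine Set.mem_iUnion.2 ⟨Nat.find hex, ⟨?_, Nat.find_spec hex, fun m hm => Nat.find_min hex hm⟩⟩
  exact lt_of_le_of_lt (Nat.find_min' hex hball) hj

/-- The first-visit events are pairwise disjoint. [folklore] -/
theorem firstDiamondVisit_disjoint {n n' : ℕ} (hne : n ≠ n') {ω : Percolation.BondConfig (Site 2)}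
    (h : ω ∈ firstDiamondVisit N K hN n) (h' : ω ∈ firstDiamondVisit N K hN n') : False := by
  rcases lt_or_gt_of_ne hne with hlt | hlt
  · exact h'.before n hlt h.hit
  · exact h.before n' hlt h'.hit

/-- The first-visit events lie in the visit event. [folklore] -/
theorem firstDiamondVisit_subset_diamondHit (n : ℕ) : firstDiamondVisit N K hN n ⊆ diamondHit N K hN :=
  fun _ h => ⟨n, h.lt_exitTime, h.hit⟩

/-- First visits happen before the sure step bound. [folklore] -/
theorem firstDiamondVisit_eq_empty_of_le {n : ℕ}
    (hn : (finite_innerCorners (thrD_adm hN)).toFinset.card ≤ n) :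
    firstDiamondVisit N K hN n = ∅ := by
  ext ω
  simp only [Set.mem_empty_iff_false, iff_false]
  intro h
  have := exitTime_le_card_innerCorners (thrD_adm hN) ω
  exact absurd h.lt_exitTime (by omega)

/-- **The first-visit event is a union of prefix classes**: with `ω₀`, every configuration making the
same first `n` exploration steps visits the diamond first at step `n`. [cite: DuminilCopinSmirnov2012Clay, §6.2, proof of Lemma 6.6] -/
theorem explorationCylinder_subset_firstDiamondVisit {n : ℕ} {ω₀ : Percolation.BondConfig (Site 2)}
    (h₀ : ω₀ ∈ firstDiamondVisit N K hN n) :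
    explorationCylinder (thrD_adm hN) ω₀ n ⊆ firstDiamondVisit N K hN n := by
  intro ω hω
  have hmin : min n (exitTime (thrD_adm hN) ω₀) = n := min_eq_left h₀.lt_exitTime.le
  have hagree : ∀ i ≤ n, orbT N hN ω i = orbT N hN ω₀ i := fun i hi => hω i (by rw [hmin]; exact hi)
  have hexit := min_succ_exitTime_eq_of_mem_explorationCylinder hω
  refine ⟨?_, ?_, ?_⟩
  · have : min (n + 1) (exitTime (thrD_adm hN) ω₀) = n + 1 := min_eq_left h₀.lt_exitTime
    rw [this] at hexit
    omega
  · rw [hagree n le_rfl]; exact h₀.hit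
  · intro m hm; rw [hagree m hm.le]; exact h₀.before m hm

end FirstHit

/-! ### The Dobrushin measure of the three-sided box as a finite sum -/

section Sums

open scoped Classical in
/-- The weight of an edge set of the interface graph under the FK Dobrushin measure. [cite: Grimmett2006, §1.2] -/
def thrWt (N : ℕ) (ω : Finset (Sym2 (ThrV N))) : ℝ :=
  rcWeight (thrD N).interfaceGraph criticalFKIsingParam 2 (Subtype.val ⁻¹' (thrD N).zdArcA) ω /
    rcPartitionFunction (thrD N).interfaceGraph criticalFKIsingParam 2 (Subtype.val ⁻¹' (thrD N).zdArcA)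

open scoped Classical in
/-- The weights are nonnegative. [cite: Grimmett2006, §1.2] -/
theorem thrWt_nonneg (N : ℕ) (ω : Finset (Sym2 (ThrV N))) : 0 ≤ thrWt N ω :=
  div_nonneg (rcWeight_nonneg _ criticalFKIsingParam_mem_Icc zero_le_two _ ω)
    (rcPartitionFunction_pos _ criticalFKIsingParam_mem_Icc two_pos _).le

/-- The FK Dobrushin measure of the three-sided box is its FK interface measure. [cite: Smirnov2010, §2.2] -/
theorem fkDobrushinMeasure_thrD_eq (N : ℕ) (hN : 1 ≤ N) :
    fkDobrushinMeasure (thrD N) = (thrD N).fkInterfaceMeasure criticalFKIsingParam 2 := by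
  have hE := thrD_adm hN
  rw [fkDobrushinMeasure_of_pos _ hE.isBounded hE.delta_pos]

open scoped Classical in
/-- **Every probability under the FK Dobrushin measure of the three-sided box is a finite weighted
sum** over the edge sets of the interface graph. [cite: Grimmett2006, §1.2] -/
theorem fkDobrushin_real_eq_sum (N : ℕ) (hN : 1 ≤ N) (S : Set (Percolation.BondConfig (Site 2))) :
    (fkDobrushinMeasure (thrD N)).real S =
      ∑ ω ∈ (thrD N).interfaceGraph.edgeFinset.powerset with liftConfig (thrD N).Ω (thrD N).δ ω ∈ S, thrWt N ω := by
  rw [fkDobrushinMeasure_thrD_eq N hN, DiscreteDobrushin.fkInterfaceMeasure_real_apply _ criticalFKIsingParam_mem_Icc two_pos,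
    Finset.sum_filter]
  refine Finset.sum_congr rfl fun ω _ => ?_
  simp only [thrWt, mul_ite, mul_one, mul_zero]

open scoped Classical in
/-- Finite additivity of the sum representation over a finite pairwise disjoint family. [folklore] -/
theorem sum_filter_mem_biUnion_eq (N : ℕ) {ι : Type*} (I : Finset ι) (S : ι → Set (Percolation.BondConfig (Site 2)))
    (hdisj : ∀ i ∈ I, ∀ j ∈ I, i ≠ j → Disjoint (S i) (S j)) :
    ∑ ω ∈ (thrD N).interfaceGraph.edgeFinset.powerset with liftConfig (thrD N).Ω (thrD N).δ ω ∈ ⋃ i ∈ I, S i, thrWt N ω =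
      ∑ i ∈ I, ∑ ω ∈ (thrD N).interfaceGraph.edgeFinset.powerset with liftConfig (thrD N).Ω (thrD N).δ ω ∈ S i, thrWt N ω := by
  simp only [Finset.sum_filter]
  rw [Finset.sum_comm]
  refine Finset.sum_congr rfl fun ω _ => ?_
  by_cases hmem : liftConfig (thrD N).Ω (thrD N).δ ω ∈ ⋃ i ∈ I, S i
  · rw [if_pos hmem]
    obtain ⟨i, hi, hωi⟩ := Set.mem_iUnion₂.1 hmem
    rw [← Finset.add_sum_erase I _ hi, if_pos hωi]
    have : ∑ j ∈ I.erase i, (if liftConfig (thrD N).Ω (thrD N).δ ω ∈ S j then thrWt N ω else 0) = 0 := by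
      refine Finset.sum_eq_zero fun j hj => ?_
      rw [Finset.mem_erase] at hj
      rw [if_neg]
      exact fun hωj => (Set.disjoint_left.1 (hdisj i hi j hj.2 hj.1.symm)) hωi hωj
    rw [this, add_zero]
  · rw [if_neg hmem]
    symm
    refine Finset.sum_eq_zero fun i hi => if_neg fun hωi => hmem (Set.mem_iUnion₂.2 ⟨i, hi, hωi⟩)

end Sums

/-! ### From the conditional lower bound to `κ P(diamond visited) ≤ P(z ↔ wired arc)` -/

section SlitBound

variable {N K : ℕ} {hN : 1 ≤ N}

open scoped Classical in
/-- **The measure of a prefix cylinder intersected with an event is the family probability times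
the measure of the cylinder**: `P(C_n(ω₀) ∩ Z) = P_{C}(Z) · P(C_n(ω₀))`, `P_C = famProb` of the
cylinder family (both sides are finite weighted sums over the members of the family).
[cite: Grimmett2006, §1.2] -/
theorem real_cylinder_inter_eq (ω₀ : Percolation.BondConfig (Site 2)) (n : ℕ) (Z : Set (Percolation.BondConfig (Site 2))) :
    (fkDobrushinMeasure (thrD N)).real (explorationCylinder (thrD_adm hN) ω₀ n ∩ Z) =
      famProb (thrD N) (cylFamily (thrD_adm hN) ω₀ n) Z * (fkDobrushinMeasure (thrD N)).real (explorationCylinder (thrD_adm hN) ω₀ n) := by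
  have hCne : (cylFamily (thrD_adm hN) ω₀ n).Nonempty := cylFamily_nonempty
  set Ztot := rcPartitionFunction (thrD N).interfaceGraph criticalFKIsingParam 2 (Subtype.val ⁻¹' (thrD N).zdArcA) with hZtot_def
  have hZtot : 0 < Ztot := rcPartitionFunction_pos _ criticalFKIsingParam_mem_Icc two_pos _
  have hfamZ : 0 < famZ (thrD N) (cylFamily (thrD_adm hN) ω₀ n) := famZ_pos hCne
  set rcW : Finset (Sym2 (ThrV N)) → ℝ := fun a =>
    rcWeight (thrD N).interfaceGraph criticalFKIsingParam 2 (Subtype.val ⁻¹' (thrD N).zdArcA) a with hrcW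
  set Epow := (thrD N).interfaceGraph.edgeFinset.powerset with hEpow
  set Cyl := explorationCylinder (thrD_adm hN) ω₀ n with hCyl
  -- everything as sums over `Epow` with indicators
  set A : ℝ := ∑ a ∈ Epow, (if liftConfig (thrD N).Ω (thrD N).δ a ∈ Cyl then
    rcW a * (if liftConfig (thrD N).Ω (thrD N).δ a ∈ Z then 1 else 0) else 0) with hA
  have hF : famZ (thrD N) (cylFamily (thrD_adm hN) ω₀ n) = ∑ a ∈ Epow, (if liftConfig (thrD N).Ω (thrD N).δ a ∈ Cyl then rcW a else 0) := by
    rw [famZ, cylFamily, Finset.sum_filter]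
  have hLHS : (fkDobrushinMeasure (thrD N)).real (Cyl ∩ Z) = A / Ztot := by
    rw [fkDobrushin_real_eq_sum N hN, Finset.sum_filter, hA, Finset.sum_div]
    refine Finset.sum_congr rfl fun a _ => ?_
    by_cases h1 : liftConfig (thrD N).Ω (thrD N).δ a ∈ Cyl
    · by_cases h2 : liftConfig (thrD N).Ω (thrD N).δ a ∈ Z
      · rw [if_pos ⟨h1, h2⟩, if_pos h1, if_pos h2, mul_one]; rfl
      · rw [if_neg (fun h => h2 h.2), if_pos h1, if_neg h2, mul_zero, zero_div]
    · rw [if_neg (fun h => h1 h.1), if_neg h1, zero_div]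
  have hPC : (fkDobrushinMeasure (thrD N)).real Cyl = famZ (thrD N) (cylFamily (thrD_adm hN) ω₀ n) / Ztot := by
    rw [fkDobrushin_real_eq_sum N hN, Finset.sum_filter, hF, Finset.sum_div]
    refine Finset.sum_congr rfl fun a _ => ?_
    split_ifs
    · rfl
    · rw [zero_div]
  have hfam : famProb (thrD N) (cylFamily (thrD_adm hN) ω₀ n) Z = A / famZ (thrD N) (cylFamily (thrD_adm hN) ω₀ n) := by
    rw [famProb, hA, Finset.sum_div]
    rw [cylFamily, Finset.sum_filter]
    refine Finset.sum_congr rfl fun a _ => ?_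
    split_ifs <;> simp [hrcW]
  rw [hLHS, hPC, hfam]
  field_simp

open scoped Classical in
/-- **Conditioning on the exploration up to the first visit of the diamond.** If, for every prefix
cylinder visiting the diamond first at step `n`, the family probability of the event `Z` is at least
`κ`, then `κ P(diamond visited before the exit) ≤ P(Z)`: the first-visit events are unions of
cylinders, the bound sums over the cylinders of each, and over the (disjoint) first-visit times.
[cite: DuminilCopinHonglerNolin2011, §4, proof of Lemma 15] -/
theorem mul_real_diamondHit_le (Z : Set (Percolation.BondConfig (Site 2))) {κ : ℝ}
    (hC : ∀ n (ω₀ : Percolation.BondConfig (Site 2)), ω₀ ∈ firstDiamondVisit N K hN n →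
      κ ≤ famProb (thrD N) (cylFamily (thrD_adm hN) ω₀ n) Z) :
    κ * (fkDobrushinMeasure (thrD N)).real (diamondHit N K hN) ≤ (fkDobrushinMeasure (thrD N)).real Z := by
  set hE := thrD_adm hN
  set P := fkDobrushinMeasure (thrD N) with hP
  haveI hprob : IsProbabilityMeasure P := by
    rw [hP, fkDobrushinMeasure_thrD_eq N hN]
    exact isProbabilityMeasure_fkInterfaceMeasure _ criticalFKIsingParam_mem_Icc two_pos
  -- the per-class bound
  have hclass : ∀ n (ω₀ : Percolation.BondConfig (Site 2)), ω₀ ∈ firstDiamondVisit N K hN n →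
      κ * P.real (explorationCylinder hE ω₀ n) ≤ P.real (explorationCylinder hE ω₀ n ∩ Z) := by
    intro n ω₀ h₀
    rw [hP, real_cylinder_inter_eq (hN := hN) ω₀ n Z]
    exact mul_le_mul_of_nonneg_right (hC n ω₀ h₀) measureReal_nonneg
  -- the per-time bound, by summing over classes
  have htime : ∀ n, κ * P.real (firstDiamondVisit N K hN n) ≤ P.real (firstDiamondVisit N K hN n ∩ Z) := by
    intro n
    have hcls : ∀ ω ∈ firstDiamondVisit N K hN n,
        κ * ∑ a ∈ (thrD N).interfaceGraph.edgeFinset.powerset with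
            liftConfig (thrD N).Ω (thrD N).δ a ∈ explorationCylinder hE ω n, thrWt N a ≤
          ∑ a ∈ (thrD N).interfaceGraph.edgeFinset.powerset with
            liftConfig (thrD N).Ω (thrD N).δ a ∈ explorationCylinder hE ω n ∩ Z, thrWt N a := by
      intro ω hω
      have := hclass n ω hω
      rw [hP, fkDobrushin_real_eq_sum N hN, fkDobrushin_real_eq_sum N hN] at this
      convert this using 4
    have key := mul_sum_le_sum_inter_of_classes (κ := κ) (thrD N).interfaceGraph.edgeFinset.powerset (thrWt N)
      (liftConfig (thrD N).Ω (thrD N).δ) (firstDiamondVisit N K hN n) Z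
      (fun ω => explorationCylinder hE ω n)
      (fun ω _ => self_mem_explorationCylinder ω n)
      (fun ω hω => explorationCylinder_subset_firstDiamondVisit hω)
      (fun ω _ ω' hω' => explorationCylinder_eq_of_mem hω') hcls
    rw [hP, fkDobrushin_real_eq_sum N hN, fkDobrushin_real_eq_sum N hN]
    convert key using 4
  -- sum over the first-visit times
  set B := (finite_innerCorners hE).toFinset.card with hB
  have hcover : diamondHit N K hN ⊆ ⋃ n ∈ Finset.range B, firstDiamondVisit N K hN n := by
    intro ω hω
    obtain ⟨n, hn⟩ := Set.mem_iUnion.1 (diamondHit_subset_iUnion_firstDiamondVisit hω)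
    refine Set.mem_iUnion₂.2 ⟨n, Finset.mem_range.2 ?_, hn⟩
    by_contra hge
    rw [firstDiamondVisit_eq_empty_of_le (not_lt.1 hge)] at hn
    exact hn
  have hdisj : ∀ i ∈ Finset.range B, ∀ j ∈ Finset.range B, i ≠ j →
      Disjoint (firstDiamondVisit N K hN i) (firstDiamondVisit N K hN j) :=
    fun i _ j _ hij => Set.disjoint_left.2 fun ω hi hj => firstDiamondVisit_disjoint hij hi hj
  have hdisjZ : ∀ i ∈ Finset.range B, ∀ j ∈ Finset.range B, i ≠ j →
      Disjoint (firstDiamondVisit N K hN i ∩ Z) (firstDiamondVisit N K hN j ∩ Z) :=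
    fun i hi j hj hij => (hdisj i hi j hj hij).mono Set.inter_subset_left Set.inter_subset_left
  have hU : P.real (⋃ n ∈ Finset.range B, firstDiamondVisit N K hN n) = ∑ n ∈ Finset.range B, P.real (firstDiamondVisit N K hN n) := by
    rw [hP, fkDobrushin_real_eq_sum N hN, sum_filter_mem_biUnion_eq N (Finset.range B) _ hdisj]
    exact Finset.sum_congr rfl fun n _ => (fkDobrushin_real_eq_sum N hN _).symm
  have hUZ : P.real (⋃ n ∈ Finset.range B, (firstDiamondVisit N K hN n ∩ Z)) =
      ∑ n ∈ Finset.range B, P.real (firstDiamondVisit N K hN n ∩ Z) := by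
    rw [hP, fkDobrushin_real_eq_sum N hN, sum_filter_mem_biUnion_eq N (Finset.range B) _ hdisjZ]
    exact Finset.sum_congr rfl fun n _ => (fkDobrushin_real_eq_sum N hN _).symm
  have hZsub : (⋃ n ∈ Finset.range B, (firstDiamondVisit N K hN n ∩ Z)) ⊆ Z :=
    Set.iUnion₂_subset fun n _ => Set.inter_subset_right
  rcases le_or_gt κ 0 with hκ | hκ
  · exact (mul_nonpos_of_nonpos_of_nonneg hκ measureReal_nonneg).trans measureReal_nonneg
  calc κ * P.real (diamondHit N K hN) ≤ κ * P.real (⋃ n ∈ Finset.range B, firstDiamondVisit N K hN n) :=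
        mul_le_mul_of_nonneg_left (measureReal_mono hcover (measure_ne_top P _)) hκ.le
    _ = ∑ n ∈ Finset.range B, κ * P.real (firstDiamondVisit N K hN n) := by rw [hU, Finset.mul_sum]
    _ ≤ ∑ n ∈ Finset.range B, P.real (firstDiamondVisit N K hN n ∩ Z) := Finset.sum_le_sum fun n _ => htime n
    _ = P.real (⋃ n ∈ Finset.range B, (firstDiamondVisit N K hN n ∩ Z)) := hUZ.symm
    _ ≤ P.real Z := measureReal_mono hZsub (measure_ne_top P _)

end SlitBound

/-! ### The ball event of the three-wired rectangle and the final assembly -/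

section Assembly

variable (N k : ℕ)

/-- The bottom-right corner `z = (N + k, 0)` of the ball (for `k ≤ N`), as a vertex of the
three-sided box: the "right-most vertex of `B_k(x)`" of Duminil-Copin's proof of Lemma 10.7.
[cite: DuminilCopinHonglerNolin2011, §4, proof of Lemma 15] -/
def ballCorner (N k : ℕ) : ThrV N :=
  ⟨![(N : ℤ) + min k N, 0], by
    rw [(threeSided (2 * N) N).meshDomain_eq, mem_threeSided_S]
    have : ((min k N : ℕ) : ℤ) ≤ N := by exact_mod_cast min_le_right k N
    simp; omega⟩

/-- The underlying site of `ballCorner N k` is `(N + k, 0)` when `k ≤ N`. [folklore] -/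
theorem ballCorner_val (hk : k ≤ N) : (ballCorner N k).1 = ![(N : ℤ) + k, 0] := by
  simp [ballCorner, min_eq_left hk]

open scoped Classical in
/-- **The ball event of the three-wired rectangle is the ball event of the three-sided box**
(transposed inclusion, idle free-arc vertices wired then un-wired):
`φ^{3 wired}_{[0,N]×[0,2N]}(B_k((0, N)) ↔ wired sides) = P_{threeSided}(some ball site ↔ A)`.
[cite: Grimmett2006, Lemma (4.13)] -/
theorem fkIsing_threeBallArm_eq_real_ballJoined (hN : 1 ≤ N) :
    (fkIsingFiniteMeasure (Percolation.rectangle N (2 * N)) (threeWired N)).real (threeBallArm N k) =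
      (fkDobrushinMeasure (thrD N)).real (ballJoined N k) := by
  -- the Dobrushin measure as the interface-graph measure
  have hD : (fkDobrushinMeasure (thrD N)).real (ballJoined N k) =
      (rcMeasure (thrD N).interfaceGraph criticalFKIsingParam 2 (Subtype.val ⁻¹' (thrD N).zdArcA)).real
        {η | DiscreteDobrushin.liftSet (thrD N) η ∈ ballJoined N k} := by
    rw [fkDobrushinMeasure_thrD_eq N hN, DiscreteDobrushin.fkInterfaceMeasure_eq_map, measureReal_def, measureReal_def,
      (DiscreteDobrushin.measurableEmbedding_liftSet (D := thrD N)).map_apply]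
    rfl
  rw [hD]
  have hWne : (rectThreeWired N).Nonempty :=
    ⟨⟨![0, 0], Finset.mem_coe.2 (Percolation.mem_rectangle_iff.2 (by simp))⟩, Or.inr (Or.inl (by simp))⟩
  have hE := edgeFinset_interfaceGraph_threeSided N (instF := SimpleGraph.fintypeEdgeSet _)
    (instR := SimpleGraph.fintypeEdgeSet _)
  rw [← rcMeasure_real_union_isolated (thrD N).interfaceGraph criticalFKIsingParam_mem_Icc two_pos
    (Subtype.val ⁻¹' (thrD N).zdArcA) (freeRow N) (freeRow_isolated N), ← thrWired_eq]
  symm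
  refine rcMeasure_real_map_of_wired (transposeEmb N) hE criticalFKIsingParam_mem_Icc two_pos hWne
    (fun u => mem_thrWired_iff N u) ?_
  intro ω hω
  have hgraph : (SimpleGraph.fromEdgeSet {e' : Sym2 (ThrV N) | e' ∈ (thrD N).interfaceGraph.edgeSet ∧
      Sym2.map Subtype.val e' ∈ DiscreteDobrushin.liftSet (thrD N) (↑(ω.map (transposeEmb N).sym2Map) : Percolation.BondConfig (ThrV N))}) =
      Percolation.openGraph (↑(ω.map (transposeEmb N).sym2Map) : Percolation.BondConfig (ThrV N)) := by
    rw [Percolation.openGraph]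
    congr 1
    ext e'
    simp only [Set.mem_setOf_eq, DiscreteDobrushin.liftSet, Set.mem_image, Finset.mem_coe]
    constructor
    · rintro ⟨-, e'', he'', heq⟩
      have : e'' = e' := Sym2.map.injective Subtype.val_injective heq
      rw [← this]; exact he''
    · intro he'
      refine ⟨?_, e', he', rfl⟩
      have : e' ∈ (ω.map (transposeEmb N).sym2Map) := he'
      have hsub : ω.map (transposeEmb N).sym2Map ⊆ (thrD N).interfaceGraph.edgeFinset := by
        rw [hE]; exact Finset.map_subset_map.2 hω
      exact SimpleGraph.mem_edgeFinset.1 (hsub this)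
  show (↑ω : Percolation.BondConfig (RectV N (2 * N))) ∈ Percolation.openCrossing Set.univ (centreBall N k) (threeWired N) ↔ _
  rw [mem_openCrossing_univ_iff (V := RectV N (2 * N)) (A := centreBall N k) (B := threeWired N)]
  simp only [Set.mem_setOf_eq, ballJoined, DiscreteDobrushin.OpenJoinedToArcA, hgraph]
  rw [exists_reachable_map_iff (transposeEmb N) ω (centreBall N k) (threeWired N)]
  constructor
  · rintro ⟨a', ⟨a, ha, rfl⟩, b', ⟨b, hb, rfl⟩, hr⟩
    refine ⟨transposeEmb N a, ?_, transposeEmb N b, ?_, hr⟩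
    · rw [mem_centreBall] at ha
      have hreg := isReg_of_mem_rectangle (Finset.mem_coe.1 a.2)
      unfold IsReg at hreg
      simp only [IsBallSite, transposeEmb_apply_val, trSite_apply_zero, trSite_apply_one]
      omega
    · have := (mem_thrWired_iff N (transposeEmb N b)).2 (fun v hv => by rw [(transposeEmb N).injective hv]; exact hb)
      rcases this with h | h
      · exact h
      · exfalso
        have hreg := isReg_of_mem_rectangle (Finset.mem_coe.1 b.2)
        unfold IsReg at hreg
        simp only [transposeEmb_apply_val, trSite_apply_one] at h; omega
  · rintro ⟨v, hv, b, hbA, hr⟩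
    have hv0 : 0 ≤ v.1 1 := hv.2.2.1
    obtain ⟨a, rfl⟩ := exists_transposeEmb_of_height N hv0
    have hb0 : 0 ≤ b.1 1 := by
      rw [zdArcA_threeSided, mem_threeSided_A] at hbA; exact hbA.2.1
    obtain ⟨w, rfl⟩ := exists_transposeEmb_of_height N hb0
    refine ⟨transposeEmb N a, ⟨a, ?_, rfl⟩, transposeEmb N w, ⟨w, ?_, rfl⟩, hr⟩
    · simp only [IsBallSite, transposeEmb_apply_val, trSite_apply_zero, trSite_apply_one] at hv
      rw [mem_centreBall]; omega
    · exact (mem_thrWired_iff N _).1 (Or.inl hbA) w rfl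

/-- **The point estimate at the corner of the ball**: `P((N + k, 0) ↔ wired arc) ≤ 2/√(N - k + 4)`
(`openJoined_sq_le_threeSided` with `X = N + k`, `d = N - k`). [cite: DuminilCopinHonglerNolin2011, §4, Lemma 15] -/
theorem real_openJoined_ballCorner_le (hN : 1 ≤ N) (hk : k + 1 ≤ N) :
    (fkDobrushinMeasure (thrD N)).real {ω | (thrD N).OpenJoinedToArcA (ballCorner N k) ω} ≤
      2 / Real.sqrt ((N : ℝ) - k + 4) := by
  have hx : (![((N + k : ℕ) : ℤ), 0] : Site 2) ∈ meshDomain (thrD N).Ω (thrD N).δ := by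
    have := (ballCorner N k).2
    rw [ballCorner_val N k (by omega)] at this
    exact_mod_cast this
  have hsq := openJoined_sq_le_threeSided (W := 2 * N) (H := N) (by omega) hN (N + k) (N - k) (by omega) (by omega)
    (by omega) (by omega) hx
  have e : ballCorner N k = ⟨![((N + k : ℕ) : ℤ), 0], hx⟩ := Subtype.ext (by rw [ballCorner_val N k (by omega)]; push_cast; rfl)
  rw [e]
  set Pr := (fkDobrushinMeasure (thrD N)).real {ω | (thrD N).OpenJoinedToArcA ⟨![((N + k : ℕ) : ℤ), 0], hx⟩ ω}
  have hP0 : 0 ≤ Pr := measureReal_nonneg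
  have hd : ((N - k : ℕ) : ℝ) = (N : ℝ) - k := by rw [Nat.cast_sub (by omega)]
  rw [hd] at hsq
  have hpos : (0 : ℝ) < (N : ℝ) - k + 4 := by
    have : (k : ℝ) + 1 ≤ N := by exact_mod_cast hk
    linarith
  rw [le_div_iff₀ (Real.sqrt_pos.2 hpos)]
  have hsq' : (Pr * Real.sqrt ((N : ℝ) - k + 4)) ^ 2 ≤ (2 : ℝ) ^ 2 := by
    rw [mul_pow, Real.sq_sqrt hpos.le]
    calc Pr ^ 2 * ((N : ℝ) - k + 4) ≤ 4 / ((N : ℝ) - k + 4) * ((N : ℝ) - k + 4) := by gcongr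
      _ = 4 := div_mul_cancel₀ _ hpos.ne'
      _ = (2 : ℝ) ^ 2 := by norm_num
  exact (pow_le_pow_iff_left₀ (by positivity) (by norm_num) two_ne_zero).1 hsq'

/-- **The conditional lower bound in the form used below**: for `K = 2k + 1` and `17K + 2 ≤ N`,
every first-visit cylinder gives the event "`ballCorner N K ↔ wired arc`" family probability at
least `√(w · slitCanonicalConst / 8) / √(k + 1)` (`famProb_openJoined_z_ge`).
[cite: DuminilCopinHonglerNolin2011, §4, proof of Lemma 15] -/
theorem slitLowerBound_ballCorner {N k : ℕ} (hN : 1 ≤ N) (hkN : 17 * (2 * k + 1) + 2 ≤ N) (n : ℕ)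
    (ω₀ : Percolation.BondConfig (Site 2)) (h₀ : ω₀ ∈ firstDiamondVisit N (2 * k + 1) hN n) :
    Real.sqrt (phantomWeight * slitCanonicalConst / 8) / Real.sqrt ((k : ℝ) + 1) ≤
      famProb (thrD N) (cylFamily (thrD_adm hN) ω₀ n) {ω | (thrD N).OpenJoinedToArcA (ballCorner N (2 * k + 1)) ω} := by
  have hK : 2 * k + 1 ≤ N := by omega
  have hz : (![(N : ℤ) + ((2 * k + 1 : ℕ) : ℤ), 0] : Site 2) ∈ meshDomain (thrD N).Ω (thrD N).δ := by
    have := (ballCorner N (2 * k + 1)).2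
    rwa [ballCorner_val N (2 * k + 1) hK] at this
  have e : ballCorner N (2 * k + 1) = ⟨![(N : ℤ) + ((2 * k + 1 : ℕ) : ℤ), 0], hz⟩ :=
    Subtype.ext (by rw [ballCorner_val N (2 * k + 1) hK])
  rw [e]
  refine le_trans ?_ (famProb_openJoined_z_ge (K := 2 * k + 1) (by omega) hkN h₀ hz)
  have hw := phantomWeight_pos
  have hc := slitCanonicalConst_pos
  rw [div_le_iff₀ (Real.sqrt_pos.2 (by positivity)), ← Real.sqrt_mul (by positivity)]
  refine Real.sqrt_le_sqrt ?_
  rw [div_mul_eq_mul_div, div_le_div_iff₀ (by norm_num) (by positivity)]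
  push_cast
  nlinarith

/-- **DCHN's Lemma 15 for balls (the strong half-plane one-arm bound, hypothesis `(hB)` of
`fkIsing_rsw_of_ballArmBound`)**: `φ^{3 wired}_{[0,N]×[0,2N]}(B_k((0, N)) ↔ wired sides) ≤ C_B ((k+1)/N)^{1/2}`.
Proof as printed: explore up to the first visit of the diamond `◇_{2k+1} ⊇ B_k`, condition on the
prefix, use the slit-domain lower bound at `z = (N + 2k + 1, 0)` and the point estimate at `z`.
[cite: DuminilCopinHonglerNolin2011, §4, Lemma 15; Proposition 14] -/
theorem fkIsing_ballArmBound :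
    ∃ C_B a : ℝ, 0 < a ∧ ∀ N : ℕ, 1 ≤ N → ∀ k : ℕ,
      (fkIsingFiniteMeasure (Percolation.rectangle N (2 * N)) (threeWired N)).real (threeBallArm N k) ≤
        C_B * (((k : ℝ) + 1) / N) ^ a := by
  set c : ℝ := Real.sqrt (phantomWeight * slitCanonicalConst / 8) with hc_def
  have hc : 0 < c := Real.sqrt_pos.2 (by have := phantomWeight_pos; have := slitCanonicalConst_pos; positivity)
  refine ⟨2 * Real.sqrt 2 / c + 6, 1 / 2, one_half_pos, fun N hN k => ?_⟩
  have hN0 : (0 : ℝ) < N := by exact_mod_cast hN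
  have hrpow : (((k : ℝ) + 1) / N) ^ (1 / 2 : ℝ) = Real.sqrt (((k : ℝ) + 1) / N) := by
    rw [Real.sqrt_eq_rpow]
  rw [hrpow]
  have hs2 : 0 < Real.sqrt 2 := Real.sqrt_pos.2 two_pos
  have hcoef : 0 ≤ 2 * Real.sqrt 2 / c := by positivity
  rcases le_or_gt N (34 * k + 18) with hbig | hsmall
  · -- large balls: the bound is trivial
    have h1 : (fkIsingFiniteMeasure (Percolation.rectangle N (2 * N)) (threeWired N)).real (threeBallArm N k) ≤ 1 :=
      measureReal_le_one
    have hge : 1 ≤ 6 * Real.sqrt (((k : ℝ) + 1) / N) := by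
      have h2k : (1 : ℝ) ≤ 36 * (((k : ℝ) + 1) / N) := by
        rw [mul_div_assoc', le_div_iff₀ hN0]
        have : (N : ℝ) ≤ 34 * k + 18 := by exact_mod_cast hbig
        linarith
      calc (1 : ℝ) = Real.sqrt 1 := Real.sqrt_one.symm
        _ ≤ Real.sqrt (36 * (((k : ℝ) + 1) / N)) := Real.sqrt_le_sqrt h2k
        _ = Real.sqrt 36 * Real.sqrt (((k : ℝ) + 1) / N) := Real.sqrt_mul (by norm_num) _
        _ = 6 * Real.sqrt (((k : ℝ) + 1) / N) := by
            rw [show (36 : ℝ) = 6 ^ 2 by norm_num, Real.sqrt_sq (by norm_num)]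
    calc (fkIsingFiniteMeasure (Percolation.rectangle N (2 * N)) (threeWired N)).real (threeBallArm N k) ≤ 1 := h1
      _ ≤ 6 * Real.sqrt (((k : ℝ) + 1) / N) := hge
      _ ≤ (2 * Real.sqrt 2 / c + 6) * Real.sqrt (((k : ℝ) + 1) / N) := by
          gcongr; linarith
  · -- small balls: explore up to the diamond `◇_{2k+1}`, use the slit bound and the point estimate
    have hkN : 17 * (2 * k + 1) + 2 ≤ N := by omega
    rw [fkIsing_threeBallArm_eq_real_ballJoined N k hN]
    haveI : IsProbabilityMeasure (fkDobrushinMeasure (thrD N)) := by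
      rw [fkDobrushinMeasure_thrD_eq N hN]
      exact isProbabilityMeasure_fkInterfaceMeasure _ criticalFKIsingParam_mem_Icc two_pos
    have hκ : 0 < c / Real.sqrt ((k : ℝ) + 1) := div_pos hc (Real.sqrt_pos.2 (by positivity))
    have hmain := mul_real_diamondHit_le (N := N) (K := 2 * k + 1) (hN := hN) {ω | (thrD N).OpenJoinedToArcA (ballCorner N (2 * k + 1)) ω}
      (κ := c / Real.sqrt ((k : ℝ) + 1)) (fun n ω₀ h₀ => slitLowerBound_ballCorner hN hkN n ω₀ h₀)
    have hjoined : (fkDobrushinMeasure (thrD N)).real (ballJoined N k) ≤ (fkDobrushinMeasure (thrD N)).real (diamondHit N (2 * k + 1) hN) :=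
      measureReal_mono (ballJoined_subset_diamondHit hN (by omega) (by omega)) (measure_ne_top _ _)
    have hpt := real_openJoined_ballCorner_le N (2 * k + 1) hN (by omega)
    -- `P(ball) ≤ (√(k+1)/c) · 2/√(N-K+4) ≤ (2√2/c) √((k+1)/N)`
    have hNk : (N : ℝ) / 2 ≤ (N : ℝ) - ((2 * k + 1 : ℕ) : ℝ) + 4 := by
      have : ((34 * k + 18 : ℕ) : ℝ) < N := by exact_mod_cast hsmall
      push_cast at this ⊢
      linarith
    have hsqrt : Real.sqrt ((N : ℝ) / 2) ≤ Real.sqrt ((N : ℝ) - ((2 * k + 1 : ℕ) : ℝ) + 4) := Real.sqrt_le_sqrt hNk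
    have hsqrtN2 : 0 < Real.sqrt ((N : ℝ) / 2) := Real.sqrt_pos.2 (by positivity)
    have hbound : (fkDobrushinMeasure (thrD N)).real (ballJoined N k) ≤
        2 * Real.sqrt 2 / c * Real.sqrt (((k : ℝ) + 1) / N) := by
      have h1 : c / Real.sqrt ((k : ℝ) + 1) * (fkDobrushinMeasure (thrD N)).real (ballJoined N k) ≤
          2 / Real.sqrt ((N : ℝ) - ((2 * k + 1 : ℕ) : ℝ) + 4) :=
        ((mul_le_mul_of_nonneg_left hjoined hκ.le).trans hmain).trans hpt
      have h2 : 2 / Real.sqrt ((N : ℝ) - ((2 * k + 1 : ℕ) : ℝ) + 4) ≤ 2 / Real.sqrt ((N : ℝ) / 2) :=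
        div_le_div_of_nonneg_left zero_le_two hsqrtN2 hsqrt
      have h3 : (fkDobrushinMeasure (thrD N)).real (ballJoined N k) ≤
          Real.sqrt ((k : ℝ) + 1) / c * (2 / Real.sqrt ((N : ℝ) / 2)) := by
        have h3a : (fkDobrushinMeasure (thrD N)).real (ballJoined N k) ≤
            2 / Real.sqrt ((N : ℝ) - ((2 * k + 1 : ℕ) : ℝ) + 4) / (c / Real.sqrt ((k : ℝ) + 1)) := (le_div_iff₀' hκ).2 h1
        have h3b : 2 / Real.sqrt ((N : ℝ) - ((2 * k + 1 : ℕ) : ℝ) + 4) / (c / Real.sqrt ((k : ℝ) + 1)) =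
            Real.sqrt ((k : ℝ) + 1) / c * (2 / Real.sqrt ((N : ℝ) - ((2 * k + 1 : ℕ) : ℝ) + 4)) := by
          rw [div_div_eq_mul_div]; ring
        rw [h3b] at h3a
        exact h3a.trans (by gcongr)
      have e : Real.sqrt ((k : ℝ) + 1) / c * (2 / Real.sqrt ((N : ℝ) / 2)) =
          2 * Real.sqrt 2 / c * Real.sqrt (((k : ℝ) + 1) / N) := by
        have hsN : Real.sqrt (N : ℝ) ≠ 0 := (Real.sqrt_pos.2 hN0).ne'
        rw [Real.sqrt_div' _ zero_le_two, Real.sqrt_div (by positivity) (N : ℝ)]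
        field_simp
      linarith [h3, e.le]
    calc (fkDobrushinMeasure (thrD N)).real (ballJoined N k) ≤ 2 * Real.sqrt 2 / c * Real.sqrt (((k : ℝ) + 1) / N) := hbound
      _ ≤ (2 * Real.sqrt 2 / c + 6) * Real.sqrt (((k : ℝ) + 1) / N) := by
          gcongr; linarith

end Assembly

end LatticeDobrushin

end Literature.Probability.LatticeModels
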